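import Literature.IUT.HodgeTheaters.ProfiniteCompletionSubgroups
import Mathlib.GroupTheory.Coprod.Basic
import Mathlib.GroupTheory.SemidirectProduct
import Mathlib.Algebra.Group.Action.End
import Mathlib.GroupTheory.Index
import HarnessLib

/-!
# Centralisers of free-factor elements in the profinite completion of a free product `A ∗ B`
# (Kurosh-free, via a wreath retraction) — THEOREMS ONLY

For groups `A`, `B`, `Γ := A ∗ B` (`Monoid.Coprod A B`), `ι = inl : A → Γ`, and a subgroup `K ≤ Γ` containing
`ι(A)`, the homomorphism `Φ : Γ → (Γ⧸K → A) ⋊ Γ`, `ι x ↦ ⟨δ_{[K]}·x, ι x⟩`, `b ↦ ⟨1, b⟩` (universal property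
of the coproduct) yields the **wreath retraction** `ρ : K → A`, `ρ k := (Φ k).left [K]`, a homomorphism with
`ρ (ι x) = x` and `ρ (δ⁻¹ ι x δ) = 1` whenever `δ ∉ K` and `δ⁻¹ ι x δ ∈ K` (`exists_wreathRetraction`; the
construction lives inside the proof, so this file declares no definition).  Consequences: free-factor
malnormality in `A ∗ B` (`inl_mem_range_of_conj_mem_range`); and, for `A` FINITE, `B` arbitrary and `1 ≠ a ∈ A`,
the centraliser of `η(ι a)` in the profinite completion `Γ̂` is contained in `η(ι A)`
(`centralizer_toCompletion_inl_le_range`; a level-by-level argument: no Kurosh subgroup theorem, no Bass–Serre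
tree, no conjugacy separability).  For `A` of prime order this gives `centralizer_toCompletion_inl_eq_zpowers`
— the statement consumed by the ROUTE-PBF P-chain (abc-iut cell, programme P-L2, rung (L3′)), here WITHOUT
the two Herfort–Ribes 1989 hypotheses it carried before.

Citations (statement shapes; nothing below is a hypothesis): free factors of `A ∗ B` are malnormal —
Magnus–Karrass–Solitar, *Combinatorial Group Theory*, §4.1 Cor. 4.1.5 «if `g ∈ A ∗ B` and both `a` and `g a g⁻¹`
are in `A`, `a ≠ 1`, then `g ∈ A`» (read first-hand, galaxy-panama 252501127331921 c506000–512000)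
[cite: MagnusKarrassSolitar1966, §4.1 Cor. 4.1.5]; free factors of free profinite products are malnormal —
Ribes–Zalesskii, *Profinite Groups*, Thm. 9.1.12 [cite: RibesZalesskii2010, Thm. 9.1.12] (hence
`C_{A ∐ B}(a) ≤ A`; Herfort–Ribes 1985 Thm. 2 / Herfort–Ribes 1989 Lemma 1.1 carry the centraliser wording —
cf. [cite: HerfortRibes1989, Lemma 1.1 (pp. 391–403, held span l.144)]).

HONEST FRAMING. Classical (pro)finite group theory about `A ∗ B` and its profinite completion; no
`def … : Prop` hypothesis; no (E)-class module and no `SettingModel*` file is imported; nothing of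
[EtTh]/[IUTchII]/[IUTchIII] in print is asserted; CELL hextΔ/hΘ UNDECIDED-AT-MODEL; no side is taken on
[IUTchIII] Cor. 3.12; nothing here says abc is proved or refuted.  abc-iut cell, ROUTE-PBF P-chain v2/v3
(seat abc-iut-w6-d081 GEN 24).
-/

namespace Literature.AnabelianGeometry.EtaleTheta.SettingModel.TreeFree

open Literature.IUT.HodgeTheaters (profiniteCompletion toCompletion)
open Literature.IUT.HodgeTheaters.ProfiniteCompletion

universe u

/-! ### The wreath retraction (discrete; `A`, `B` arbitrary groups) -/

section Wreath

variable {A B : Type u} [Group A] [Group B]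

/-- **The wreath retraction.**  For `K ≤ A ∗ B` containing `ι(A)` there is a homomorphism `ρ : K → A` with
`ρ (ι x) = x` and `ρ (δ⁻¹ ι x δ) = 1` whenever `δ ∉ K` and `δ⁻¹ ι x δ ∈ K`.  Construction (inside the proof):
`Φ = Coprod.lift (x ↦ ⟨δ_{[K]}·x, ι x⟩) (b ↦ ⟨1, b⟩) : A ∗ B → (A ∗ B ⧸ K → A) ⋊ (A ∗ B)` and
`ρ k = (Φ k).left [K]`; the coordinate cocycle `(Φ (g h)).left c = (Φ g).left c · (Φ h).left (g⁻¹ • c)` gives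
multiplicativity on the stabiliser `K` of `[K]`, and `(Φ (δ⁻¹ ι x δ)).left [K] = h⁻¹ · δ_{[K]}(δ[K])·x · h = 1`
for `δ ∉ K`. [cite: MagnusKarrassSolitar1966, §4.1 Cor. 4.1.5] -/
theorem exists_wreathRetraction (K : Subgroup (Monoid.Coprod A B))
    (hK : (Monoid.Coprod.inl : A →* Monoid.Coprod A B).range ≤ K) :
    ∃ ρ : K →* A, (∀ x : A, ρ ⟨Monoid.Coprod.inl x, hK ⟨x, rfl⟩⟩ = x) ∧
      ∀ (x : A) (δ : Monoid.Coprod A B), δ ∉ K →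
        ∀ hmem : δ⁻¹ * Monoid.Coprod.inl x * δ ∈ K, ρ ⟨δ⁻¹ * Monoid.Coprod.inl x * δ, hmem⟩ = 1 := by
  classical
  -- the base coset and its stabiliser
  let c₀ : Monoid.Coprod A B ⧸ K := ((1 : Monoid.Coprod A B) : Monoid.Coprod A B ⧸ K)
  have smul_c₀ : ∀ {k : Monoid.Coprod A B}, k ∈ K → k • c₀ = c₀ := by
    intro k hk
    rw [MulAction.Quotient.smul_mk, smul_eq_mul, mul_one, eq_comm, QuotientGroup.eq, inv_one, one_mul]
    exact hk
  have mem_of_smul : ∀ {δ : Monoid.Coprod A B}, δ • c₀ = c₀ → δ ∈ K := by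
    intro δ h
    rw [MulAction.Quotient.smul_mk, smul_eq_mul, mul_one, eq_comm, QuotientGroup.eq, inv_one, one_mul] at h
    exact h
  have arrow : ∀ (g : Monoid.Coprod A B) (f : Monoid.Coprod A B ⧸ K → A) (c : Monoid.Coprod A B ⧸ K),
      (mulAutArrow g f) c = f (g⁻¹ • c) := fun _ _ _ => rfl
  -- the `A`-part of `Φ`
  let ΦA : A →* (Monoid.Coprod A B ⧸ K → A) ⋊[mulAutArrow] Monoid.Coprod A B :=
    { toFun := fun x => ⟨Pi.mulSingle c₀ x, Monoid.Coprod.inl x⟩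
      map_one' := by
        ext
        · simp
        · simp
      map_mul' := fun x y => by
        ext c
        · simp only [SemidirectProduct.mul_left, Pi.mul_apply, arrow]
          have hfix : (Monoid.Coprod.inl x : Monoid.Coprod A B)⁻¹ • c = c₀ ↔ c = c₀ := by
            constructor
            · intro h
              have := congrArg (fun d => (Monoid.Coprod.inl x : Monoid.Coprod A B) • d) h
              simp only [smul_inv_smul] at this
              rw [this, smul_c₀ (hK ⟨x, rfl⟩)]
            · intro h
              rw [h, smul_c₀ (K.inv_mem (hK ⟨x, rfl⟩))]
          by_cases hc : c = c₀
          · subst hc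
            rw [hfix.mpr rfl]
            simp
          · have hc' : (Monoid.Coprod.inl x : Monoid.Coprod A B)⁻¹ • c ≠ c₀ := fun h => hc (hfix.mp h)
            simp [Pi.mulSingle_eq_of_ne hc, Pi.mulSingle_eq_of_ne hc']
        · simp }
  let Φ : Monoid.Coprod A B →* (Monoid.Coprod A B ⧸ K → A) ⋊[mulAutArrow] Monoid.Coprod A B :=
    Monoid.Coprod.lift ΦA (SemidirectProduct.inr.comp Monoid.Coprod.inr)
  -- `Φ` lifts the identity
  have Φ_right : ∀ g, (Φ g).right = g := by
    have h : SemidirectProduct.rightHom.comp Φ = MonoidHom.id _ := by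
      apply Monoid.Coprod.hom_ext
      · ext x; simp [Φ, ΦA]
      · ext b; simp [Φ]
    exact fun g => DFunLike.congr_fun h g
  have Φ_inl : ∀ x : A, (Φ (Monoid.Coprod.inl x)).left = Pi.mulSingle c₀ x := fun x => by simp [Φ, ΦA]
  -- the coordinate cocycle and its consequence for inverses
  have Φ_mul : ∀ (g h : Monoid.Coprod A B) (c : Monoid.Coprod A B ⧸ K),
      (Φ (g * h)).left c = (Φ g).left c * (Φ h).left (g⁻¹ • c) := fun g h c => by
    rw [map_mul, SemidirectProduct.mul_left, Pi.mul_apply, arrow, Φ_right]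
  have Φ_inv : ∀ (g : Monoid.Coprod A B) (c : Monoid.Coprod A B ⧸ K),
      (Φ g⁻¹).left c = ((Φ g).left (g • c))⁻¹ := fun g c => by
    have h := Φ_mul g⁻¹ g c
    rw [inv_mul_cancel, map_one, SemidirectProduct.one_left, Pi.one_apply, inv_inv] at h
    exact eq_inv_of_mul_eq_one_left h.symm
  -- the retraction
  let ρ : K →* A :=
    { toFun := fun k => (Φ (k : Monoid.Coprod A B)).left c₀
      map_one' := by simp
      map_mul' := fun k k' => by
        simp only [Subgroup.coe_mul]
        rw [Φ_mul, smul_c₀ (K.inv_mem k.2)] }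
  refine ⟨ρ, fun x => ?_, fun x δ hδ hmem => ?_⟩
  · -- `ρ (ι x) = x`
    change (Φ (Monoid.Coprod.inl x)).left c₀ = x
    rw [Φ_inl, Pi.mulSingle_eq_same]
  · -- `ρ (δ⁻¹ ι x δ) = 1`
    change (Φ (δ⁻¹ * Monoid.Coprod.inl x * δ)).left c₀ = 1
    rw [Φ_mul, Φ_mul, Φ_inv, Φ_inl, inv_inv]
    have hne : δ • c₀ ≠ c₀ := fun h => hδ (mem_of_smul h)
    rw [Pi.mulSingle_eq_of_ne hne, mul_one]
    have hfix : (δ⁻¹ * Monoid.Coprod.inl x : Monoid.Coprod A B)⁻¹ • c₀ = δ • c₀ := by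
      have hmem' : δ⁻¹ * (Monoid.Coprod.inl x)⁻¹ * δ ∈ K := by
        have := K.inv_mem hmem
        simpa [mul_inv_rev, mul_assoc] using this
      have h2 : (δ⁻¹ * (Monoid.Coprod.inl x)⁻¹ * δ) • c₀ = c₀ := smul_c₀ hmem'
      have h3 := congrArg (fun d => δ • d) h2
      simp only [mul_smul, smul_inv_smul] at h3
      rw [mul_inv_rev, inv_inv, mul_smul]
      exact h3
    rw [hfix, inv_mul_cancel]

/-- **Free-factor malnormality in `A ∗ B`** (the case `K = ι(A)`): if `δ⁻¹ ι x δ ∈ ι(A)` with `x ≠ 1`, then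
`δ ∈ ι(A)` (Magnus–Karrass–Solitar Cor. 4.1.5, with `g = δ⁻¹`). [cite: MagnusKarrassSolitar1966, §4.1 Cor. 4.1.5] -/
theorem inl_mem_range_of_conj_mem_range {x : A} (hx : x ≠ 1) {δ : Monoid.Coprod A B}
    (h : δ⁻¹ * Monoid.Coprod.inl x * δ ∈ (Monoid.Coprod.inl : A →* Monoid.Coprod A B).range) :
    δ ∈ (Monoid.Coprod.inl : A →* Monoid.Coprod A B).range := by
  by_contra hδ
  obtain ⟨ρ, hρ, hρ'⟩ := exists_wreathRetraction (Monoid.Coprod.inl : A →* Monoid.Coprod A B).range le_rfl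
  have h1 := hρ' x δ hδ h
  obtain ⟨y, hy⟩ := MonoidHom.mem_range.mp h
  have h2 : ρ ⟨δ⁻¹ * Monoid.Coprod.inl x * δ, h⟩ = y := by
    have : (⟨δ⁻¹ * Monoid.Coprod.inl x * δ, h⟩ : (Monoid.Coprod.inl : A →* Monoid.Coprod A B).range) =
        ⟨Monoid.Coprod.inl y, ⟨y, rfl⟩⟩ := Subtype.ext hy.symm
    rw [this, hρ]
  have hy1 : y = 1 := h2.symm.trans h1
  rw [hy1, map_one] at hy
  have h4 : Monoid.Coprod.inl x = (1 : Monoid.Coprod A B) := by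
    have h5 : δ⁻¹ * Monoid.Coprod.inl x * δ = 1 := hy.symm
    have h6 := congrArg (fun t => δ * t * δ⁻¹) h5
    simpa [mul_assoc] using h6
  exact hx (Monoid.Coprod.inl_injective (h4.trans (map_one _).symm))

end Wreath

/-! ### Centralisers of factor elements in the profinite completion (`A` finite, `B` arbitrary) -/

section Centralizer

variable {A B : Type u} [Group A] [Group B]

/-- One level of a commutation relation: if `γ̂` fixes `η g` under conjugation and `γ̂.val N = [c]`, then
`g⁻¹ (c⁻¹ g c) ∈ N`. [cite: RibesZalesskii2010, §3.2] -/
theorem inv_mul_conj_mem_of_val_eq {Γ : Type u} [Group Γ] {g : Γ} (γ : profiniteCompletion Γ)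
    (hγ : γ * toCompletion Γ g * γ⁻¹ = toCompletion Γ g) (N : FiniteIndexNormalSubgroup Γ) (c : Γ)
    (hc : γ.val N = (QuotientGroup.mk c : Γ ⧸ N.toSubgroup)) :
    g⁻¹ * (c⁻¹ * g * c) ∈ N.toSubgroup := by
  have h1 := mk_conj_eq_of_conj_eq γ hγ N c hc
  rw [QuotientGroup.eq] at h1
  have h2 := N.isNormal'.conj_mem _ h1 c⁻¹
  convert h2 using 1
  group

/-- **Centraliser of a free-factor element in `(A ∗ B)^`** (`A` finite, `B` any group, `1 ≠ a ∈ A`): every element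
of the profinite completion of `A ∗ B` commuting with `η(ι a)` lies in `η(ι A)`.  Kurosh-free proof: at a level `N`
with `γ̂ ≡ η(α)`, if `α ∉ K := N·ι(A)` then the wreath retraction `ρ : K → A` kills `α⁻¹ ι a α`; at a level
`M ≤ N ∩ ker ρ` with `γ̂ ≡ η(αn)`, `n ∈ N`, the element `(αn)⁻¹ ι a (αn) ∈ ι a · M` has `ρ`-value both `1` and
`a`.  (Shape: Herfort–Ribes 1985 `C_{A ∐ B}(a) = C_A(a)`; a consequence of the malnormality of free factors of
free profinite products, Ribes–Zalesskii Thm. 9.1.12; here the completion-of-`A ∗ B` model.)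
[cite: RibesZalesskii2010, Thm. 9.1.12] -/
theorem centralizer_toCompletion_inl_le_range [Finite A] {a : A} (ha : a ≠ 1) :
    Subgroup.centralizer ({toCompletion (Monoid.Coprod A B) (Monoid.Coprod.inl a)} :
        Set (profiniteCompletion (Monoid.Coprod A B))) ≤
      ((toCompletion (Monoid.Coprod A B)).comp (Monoid.Coprod.inl : A →* Monoid.Coprod A B)).range := by
  intro γ hγ
  set ι : A →* Monoid.Coprod A B := Monoid.Coprod.inl with hιdef
  have hγ' : γ * toCompletion _ (ι a) * γ⁻¹ = toCompletion _ (ι a) := by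
    rw [Subgroup.mem_centralizer_iff] at hγ
    rw [← hγ _ (Set.mem_singleton _), mul_inv_cancel_right]
  -- it suffices that every shadow of `γ` lies in the image of `ι(A)`
  suffices hval : ∀ N : FiniteIndexNormalSubgroup (Monoid.Coprod A B),
      γ.val N ∈ (ι.range).map (QuotientGroup.mk' N.toSubgroup) by
    have hcl := mem_closure_image_of_forall_val_mem hval
    have hfin : (toCompletion (Monoid.Coprod A B) '' (ι.range : Set (Monoid.Coprod A B))).Finite := by
      rw [MonoidHom.coe_range]
      exact (Set.finite_range ι).image _
    rw [hfin.isClosed.closure_eq] at hcl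
    obtain ⟨g, ⟨x, rfl⟩, hgx⟩ := hcl
    exact ⟨x, hgx⟩
  intro N
  by_contra hnot
  obtain ⟨α, hα⟩ := QuotientGroup.mk_surjective (γ.val N)
  -- the finite-index subgroup `K = N · ι(A)` of this level
  set K : Subgroup (Monoid.Coprod A B) := N.toSubgroup ⊔ ι.range with hKdef
  have hNK : N.toSubgroup ≤ K := le_sup_left
  have hιK : ι.range ≤ K := le_sup_right
  haveI : K.FiniteIndex := Subgroup.finiteIndex_of_le hNK
  -- `α ∉ K` (otherwise the shadow would lie in the image of `ι(A)`)
  have hαK : α ∉ K := by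
    intro hαK'
    apply hnot
    have hαK'' : α ∈ ((N.toSubgroup ⊔ ι.range : Subgroup (Monoid.Coprod A B)) :
        Set (Monoid.Coprod A B)) := hαK'
    rw [Subgroup.normal_mul] at hαK''
    obtain ⟨n, hn, y, hy, hny⟩ := Set.mem_mul.mp hαK''
    rw [← hα, ← hny]
    refine ⟨y, hy, ?_⟩
    rw [QuotientGroup.mk'_apply, QuotientGroup.eq]
    simpa [mul_assoc] using N.isNormal'.conj_mem _ hn y⁻¹
  -- `α⁻¹ ι a α ∈ ι a · N ⊆ K`
  have h1 : (ι a)⁻¹ * (α⁻¹ * ι a * α) ∈ N.toSubgroup := inv_mul_conj_mem_of_val_eq γ hγ' N α hα.symm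
  have hconjK : α⁻¹ * ι a * α ∈ K := by
    have : α⁻¹ * ι a * α = ι a * ((ι a)⁻¹ * (α⁻¹ * ι a * α)) := by group
    rw [this]
    exact K.mul_mem (hιK ⟨a, rfl⟩) (hNK h1)
  -- the wreath retraction `ρ : K → A` kills `α⁻¹ ι a α`
  obtain ⟨ρ, hρ, hρ'⟩ := exists_wreathRetraction K hιK
  have hρ1 : ρ ⟨α⁻¹ * ι a * α, hconjK⟩ = 1 := hρ' a α hαK hconjK
  -- a deeper level `M ≤ N` inside the kernel of `ρ`
  set L : Subgroup (Monoid.Coprod A B) := ρ.ker.map K.subtype with hLdef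
  haveI : L.FiniteIndex :=
    ⟨by rw [hLdef, Subgroup.index_map_subtype]
        exact mul_ne_zero Subgroup.FiniteIndex.index_ne_zero Subgroup.FiniteIndex.index_ne_zero⟩
  let C : FiniteIndexNormalSubgroup (Monoid.Coprod A B) := FiniteIndexNormalSubgroup.ofSubgroup L.normalCore
  set M : FiniteIndexNormalSubgroup (Monoid.Coprod A B) := N ⊓ C with hMdef
  have hMN : M ≤ N := inf_le_left
  have hML : ∀ y, y ∈ M.toSubgroup → y ∈ L := by
    intro y hy
    have hy' : y ∈ C := (inf_le_right : M ≤ C) hy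
    exact Subgroup.normalCore_le L hy'
  obtain ⟨β, hβ⟩ := QuotientGroup.mk_surjective (γ.val M)
  -- `β ≡ α (mod N)`
  have hβN : γ.val N = QuotientGroup.mk β := val_mk_eq_of_le γ hMN β hβ.symm
  have hn : α⁻¹ * β ∈ N.toSubgroup := by
    rw [← QuotientGroup.eq, hα, hβN]
  -- `β⁻¹ ι a β ∈ ι a · M`
  have h2 : (ι a)⁻¹ * (β⁻¹ * ι a * β) ∈ M.toSubgroup := inv_mul_conj_mem_of_val_eq γ hγ' M β hβ.symm
  obtain ⟨m, hmker, hm⟩ := Subgroup.mem_map.mp (hML _ h2)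
  -- `β⁻¹ ι a β ∈ K`, and its `ρ`-value computed two ways
  have hβK : β⁻¹ * ι a * β ∈ K := by
    have : β⁻¹ * ι a * β = (α⁻¹ * β)⁻¹ * (α⁻¹ * ι a * α) * (α⁻¹ * β) := by group
    rw [this]
    exact K.mul_mem (K.mul_mem (K.inv_mem (hNK hn)) hconjK) (hNK hn)
  have hway1 : ρ ⟨β⁻¹ * ι a * β, hβK⟩ = 1 := by
    have : (⟨β⁻¹ * ι a * β, hβK⟩ : K) =
        ⟨α⁻¹ * β, hNK hn⟩⁻¹ * ⟨α⁻¹ * ι a * α, hconjK⟩ * ⟨α⁻¹ * β, hNK hn⟩ :=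
      Subtype.ext (by simp only [Subgroup.coe_mul, Subgroup.coe_inv]; group)
    rw [this, map_mul, map_mul, map_inv, hρ1, mul_one, inv_mul_cancel]
  have hway2 : ρ ⟨β⁻¹ * ι a * β, hβK⟩ = a := by
    have : (⟨β⁻¹ * ι a * β, hβK⟩ : K) = ⟨ι a, hιK ⟨a, rfl⟩⟩ * m :=
      Subtype.ext (by
        simp only [Subgroup.coe_mul]
        rw [show ((m : K) : Monoid.Coprod A B) = K.subtype m from rfl, hm]
        group)
    rw [this, map_mul, hρ, (MonoidHom.mem_ker).mp hmker, mul_one]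
  exact ha (hway2.symm.trans hway1)

/-- **(HR85c) at a prime-order factor, no hypotheses**: for `|A| = p` prime and `1 ≠ a ∈ A`, the centraliser of
`η(ι a)` in `(A ∗ B)^` is `⟨η(ι a)⟩`.  Same statement as the ROUTE-PBF P-chain's
`centralizer_toCompletion_inl_eq_zpowers`, without the two Herfort–Ribes hypotheses. [cite: RibesZalesskii2010, Thm. 9.1.12] -/
theorem centralizer_toCompletion_inl_eq_zpowers [Fintype A] (hA : (Fintype.card A).Prime) {a : A}
    (ha : a ≠ 1) :
    Subgroup.centralizer ({toCompletion (Monoid.Coprod A B) (Monoid.Coprod.inl a)} :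
        Set (profiniteCompletion (Monoid.Coprod A B))) =
      Subgroup.zpowers (toCompletion (Monoid.Coprod A B) (Monoid.Coprod.inl a)) := by
  apply le_antisymm
  · intro γ hγ
    obtain ⟨x, rfl⟩ := centralizer_toCompletion_inl_le_range (B := B) ha hγ
    haveI : Fact (Nat.card A).Prime := ⟨by rwa [Nat.card_eq_fintype_card]⟩
    obtain ⟨k, rfl⟩ := Subgroup.mem_zpowers_iff.mp (mem_zpowers_of_prime_card (g' := x) rfl ha)
    exact ⟨k, by simp [map_zpow]⟩
  · rw [Subgroup.zpowers_le]
    exact Subgroup.mem_centralizer_singleton_iff.mpr rfl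

/-- Membership form: every `γ ∈ (A ∗ B)^` commuting with `η(ι a)`, `|A|` prime, `a ≠ 1`, lies in `η(ι A)`.
[cite: RibesZalesskii2010, Thm. 9.1.12] -/
theorem mem_range_inl_of_commute_of_card_prime [Fintype A] (hA : (Fintype.card A).Prime) {a : A}
    (ha : a ≠ 1) (γ : profiniteCompletion (Monoid.Coprod A B))
    (hγ : γ * toCompletion (Monoid.Coprod A B) (Monoid.Coprod.inl a) =
      toCompletion (Monoid.Coprod A B) (Monoid.Coprod.inl a) * γ) :
    γ ∈ Set.range (toCompletion (Monoid.Coprod A B) ∘ (Monoid.Coprod.inl : A →* Monoid.Coprod A B)) := by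
  have hmem : γ ∈ Subgroup.centralizer ({toCompletion (Monoid.Coprod A B) (Monoid.Coprod.inl a)} :
      Set (profiniteCompletion (Monoid.Coprod A B))) :=
    Subgroup.mem_centralizer_singleton_iff.mpr hγ
  rw [centralizer_toCompletion_inl_eq_zpowers hA ha, Subgroup.mem_zpowers_iff] at hmem
  obtain ⟨k, rfl⟩ := hmem
  exact ⟨a ^ k, by simp⟩

end Centralizer

end Literature.AnabelianGeometry.EtaleTheta.SettingModel.TreeFree
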